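import Literature.NumberTheory.LFunctions.CertifiedDirichletLTuringMethodZeroCountProofs
import Literature.NumberTheory.LFunctions.CertifiedDirichletLTuringMethodProofs
import Literature.NumberTheory.LFunctions.TuringLowerBound
import HarnessLib

/-!
# Turing's method for Dirichlet `L`-functions: the lower bound for `∫_{1/2}^∞ log|L(σ+it, χ)| dσ`
# — the elementary part of Trudgian 2011, Lemma 3.7 (Rumely 1993, (13)–(15), (21)–(24)), proved

T. S. Trudgian, *Improvements to Turing's method*, Math. Comp. **80** (2011), §3.4 (proof of
Lemma 3.7; arXiv:0903.1885 pp. 9–10); R. Rumely, Math. Comp. **61** (1993), pp. 430–432.  The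
Dirichlet-`L` twin of the tree's `TuringLowerBound.lean` (`ζ`: Trudgian Lemma 2.11), first layer.
Everything here is a theorem; no new named fact.

Trudgian's proof of the lower bound `−∫_{½}^{∞} log|L(σ+it, χ)| dσ ≤ a₂ + b₂ log(Qt/2π)` writes
(for `σ > 1`, `log|L(s, χ)| ≥ log ζ(2σ) − log ζ(σ)`)

  `∫_{½}^{∞} log|L| = ∫_{½}^{½+d} log|L(s, χ)/L(s+d, χ)| dσ + [∫_{½+d}^{∞} + ∫_{½+d}^{½+2d}] log|L| `
  `  ≥ (d²/2) log(Q/π) + I₁ + I₂ + I(d)`,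

with `I₁` the `Γ`-quotient integral, `I₂ = Σ_ρ ∫ log|(s−ρ)/(s+d−ρ)| dσ` the zeros' part (Weierstrass
product) and `I(d)` the `ζ(2σ)/ζ(σ)` integrals.  This file proves the decomposition, the bound
`≥ I(d)` of the two outer integrals, and the `(d²/2) log(Q/π) + I₁` part in the sharper pointwise
form `Re (ξ'/ξ − L'/L)(x + it, χ) = ½ log(Q/π) + ½ Re ψ((x + a + it)/2) ≥ ½ log(Qt/2π) − ε(t)`
(the explicit vertical Stirling bound of the tree, `log_norm_sub_le_re_digamma`, in place of the
mean-value step of Trudgian / Rumely (22)–(24)); what is NOT proved here is the zeros' part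
`I₂ ≥ −d²(log 4) Re ξ'/ξ(½ + d + it, χ)` (Trudgian, displays after Lemma 3.6, via the Weierstrass
product and his Lemma 2.7 = Booker's inequality), isolated as the hypothesis of the last theorem.

* `TuringDirichlet.log_norm_LFunction_two_mul_sub_le` — `log ζ(2σ) − log ζ(σ) ≤ log|L(σ+it, χ)|`,
  `σ > 1` (Trudgian p. 9 last display / Rumely (13): Euler product; the tree's Booker (4–12)).
* `TuringDirichlet.setIntegral_Ioi_log_norm_LFunction_ge`, `intervalIntegral_log_norm_LFunction_ge`
  — the two `I(d)` integrals (`½ < d`): `∫_{½+d}^{∞} log|L| ≥ ½∫_{1+2d}^{∞} log ζ − ∫_{½+d}^{∞} log ζ`,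
  `∫_{½+d}^{½+2d} log|L| ≥ ½∫_{1+2d}^{1+4d} log ζ − ∫_{½+d}^{½+2d} log ζ` (so their sum is
  `≥ turingI d`, Trudgian's `I(d)` of §2.2, the tree's `turingI`).
* `TuringDirichlet.setIntegral_Ioi_half_log_norm_LFunction_eq_decomp` — the decomposition above.
* `TuringDirichlet.re_logDeriv_dirichletXi_sub_eq`, `re_logDeriv_dirichletXi_sub_ge` — the non-`L`
  part of `ξ'/ξ(s, χ)` (`ξ(s, χ) = (Q/π)^{(s+a)/2} Γ((s+a)/2) L(s, χ)`, MV (10.19), the tree's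
  `DirichletTheta.dirichletXi`): `= ½ log(Q/π) + ½ Re ψ((s+a)/2) ≥ ½ log Q + ½ log t − ½ log 2π − ε(t)`
  for `Re s ≥ ½`, `t ≥ 1` (`ε(t) = turingEps t = 3/(2t²) + π/(4t)`, the `ζ`-file's error).
* `TuringDirichlet.log_norm_LFunction_sub_shift_ge`, `integral_log_norm_LFunction_sub_shift_ge` —
  `∫_{½}^{½+d} (log|L(s)| − log|L(s+d)|) ≥ ∫_{½}^{½+d} (log|ξ(s,χ)| − log|ξ(s+d,χ)|)
   + d²(½ log(Qt) − ½ log 2π − ε(t))` (Trudgian's `(d²/2) log(Q/π) + I₁`, with his mean-value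
   estimate of `I₁` replaced by the pointwise Stirling bound).
* `TuringDirichlet.neg_setIntegral_Ioi_half_log_norm_LFunction_le_of_xi_bound` — the assembly of
  Lemma 3.7 modulo the zeros' part: if `∫_{½}^{½+d}(log|ξ(s,χ)| − log|ξ(s+d,χ)|) dσ ≥ −X`, then
  `−∫_{½}^{∞} log|L(σ+it, χ)| dσ ≤ X − d²(½ log(Qt) − ½ log 2π − ε(t)) − I(d)`.

Conventions: `L(s, χ) = χ.LFunction s`, `ξ(s, χ) = DirichletTheta.dirichletXi χ s`, `a = charParity χ`,
`Q = q`, "`t` not an ordinate" = `∀ ρ ∈ charNontrivialZeros χ, ρ.im ≠ t`.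

## References
* T. S. Trudgian, Improvements to Turing's method, Math. Comp. 80 (2011) 2259–2279, §3.4 proof of
  Lemma 3.7 (arXiv:0903.1885 pp. 9–10). [Trudgian2011]
* R. Rumely, Numerical computations concerning the ERH, Math. Comp. 61 (1993) 415–440, (13)–(17),
  (21)–(24), pp. 430–432. [Rumely1993ERH]
* H. L. Montgomery, R. C. Vaughan, Multiplicative Number Theory I, (10.19). [MontgomeryVaughan2007]
-/

noncomputable section

open Complex Set MeasureTheory intervalIntegral Filter Topology
open scoped Real

namespace Literature.NumberTheory.LFunctions

open DirichletTheta DirichletCharacter ExplicitPsiChar Booker2006Turing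

namespace TuringDirichlet

variable {q : ℕ} [NeZero q] {χ : DirichletCharacter ℂ q}

/-! ### `log|L(s, χ)| ≥ log ζ(2σ) − log ζ(σ)` for `σ > 1`, and the `I(d)` integrals -/

/-- **Trudgian 2011, §3.4 (arXiv p. 9, last display) / Rumely 1993 (13):** for `σ > 1`,
"`log|L(s, χ)| = −Σ_p log|1 − χ(p)p^{−s}| ≥ −Σ_p log(1 + p^{−σ}) = log ζ(2σ) − log ζ(σ)`"
(the tree's Booker envelope `smallZ_le_norm_LFunction`, (4–12)).
[cite: Trudgian2011, §3.4 proof of Lemma 3.7 (first display)] -/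
theorem log_norm_LFunction_two_mul_sub_le (χ : DirichletCharacter ℂ q) {σ : ℝ} (hσ : 1 < σ)
    (t : ℝ) :
    Real.log ‖riemannZeta ((2 * σ : ℝ) : ℂ)‖ - Real.log ‖riemannZeta (σ : ℂ)‖ ≤
      Real.log ‖χ.LFunction (σ + t * I)‖ := by
  have h := smallZ_le_norm_LFunction χ hσ t
  have h0 := smallZ_pos hσ
  have hlog := Real.log_le_log h0 h
  rw [smallZ_eq_div hσ, bigZ_eq_norm (by linarith), bigZ_eq_norm hσ,
    Real.log_div (norm_ne_zero_iff.mpr (riemannZeta_ne_zero_of_one_lt_re (by simp; linarith)))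
      (norm_ne_zero_iff.mpr (riemannZeta_ne_zero_of_one_lt_re (by simp [hσ])))] at hlog
  exact hlog

/-- `L(x + it, χ) ≠ 0` for `x ≥ ½` when `t` is the ordinate of no non-trivial zero (`χ ≠ 1`).
[folklore] -/
private theorem LFunction_ne_zero_of_half_le' (h1 : χ ≠ 1) {t : ℝ}
    (ht : ∀ ρ ∈ charNontrivialZeros χ, ρ.im ≠ t) {x : ℝ} (hx : 1 / 2 ≤ x) :
    χ.LFunction (x + t * I) ≠ 0 := by
  intro hL
  rcases lt_or_ge x 1 with hx1 | hx1
  · exact ht _ (mem_charNontrivialZeros.2 ⟨hL, by simp; linarith, by simpa using hx1⟩) (by simp)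
  · exact LFunction_ne_zero_of_one_le_re χ (Or.inl h1) (by simpa using hx1) hL

/-- `σ ↦ log|L(σ + it, χ)|` is interval integrable on any `[a, b]` with `½ ≤ a, b` (`t` not an
ordinate). [folklore] -/
private theorem intervalIntegrable_log_norm_LFunction (h1 : χ ≠ 1) {t a b : ℝ}
    (ht : ∀ ρ ∈ charNontrivialZeros χ, ρ.im ≠ t) (ha : 1 / 2 ≤ a) (hb : 1 / 2 ≤ b) :
    IntervalIntegrable (fun x : ℝ ↦ Real.log ‖χ.LFunction (x + t * I)‖) volume a b := by
  have h := integrableOn_log_norm_LFunction h1 ht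
  have key : ∀ a b : ℝ, 1 / 2 ≤ a → a ≤ b →
      IntervalIntegrable (fun x : ℝ ↦ Real.log ‖χ.LFunction (x + t * I)‖) volume a b :=
    fun a b ha hab ↦ (intervalIntegrable_iff_integrableOn_Ioc_of_le hab).2
      (h.mono_set fun x hx ↦ lt_of_le_of_lt ha hx.1)
  rcases le_total a b with hab | hab
  · exact key a b ha hab
  · exact (key b a hb hab).symm

/-- **The `I(d)` bound, unbounded part** (Trudgian §3.4 "where `I(d)` is the same function defined
in" §2.2 — the tree's `turingI`; Rumely (14)): for `½ < d` and `t` not an ordinate,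
`∫_{½+d}^∞ log|L(σ+it, χ)| dσ ≥ ½∫_{1+2d}^∞ log ζ − ∫_{½+d}^∞ log ζ`.
[cite: Trudgian2011, §3.4 proof of Lemma 3.7 (definition of I(d))] -/
theorem setIntegral_Ioi_log_norm_LFunction_ge (h1 : χ ≠ 1) {d t : ℝ} (hd : 1 / 2 < d)
    (ht : ∀ ρ ∈ charNontrivialZeros χ, ρ.im ≠ t) :
    1 / 2 * (∫ σ in Ioi (1 + 2 * d), Real.log ‖riemannZeta σ‖) -
        (∫ σ in Ioi (1 / 2 + d), Real.log ‖riemannZeta σ‖) ≤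
      ∫ σ in Ioi (1 / 2 + d), Real.log ‖χ.LFunction (σ + t * I)‖ := by
  have hc : 1 < 1 / 2 + d := by linarith
  have hL : IntegrableOn (fun σ : ℝ ↦ Real.log ‖χ.LFunction (σ + t * I)‖) (Ioi (1 / 2 + d)) :=
    (integrableOn_log_norm_LFunction h1 ht).mono_set (Ioi_subset_Ioi (by linarith))
  have hR1 : IntegrableOn (fun σ : ℝ ↦ Real.log ‖riemannZeta σ‖) (Ioi (1 / 2 + d)) :=
    integrableOn_log_norm_riemannZeta_ofReal hc
  have hR2 : IntegrableOn (fun σ : ℝ ↦ Real.log ‖riemannZeta ((2 * σ : ℝ) : ℂ)‖) (Ioi (1 / 2 + d)) := by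
    have h := (integrableOn_Ioi_comp_mul_left_iff (fun u : ℝ ↦ Real.log ‖riemannZeta u‖)
      (1 / 2 + d) (a := 2) two_pos).2
    have e : (2 : ℝ) * (1 / 2 + d) = 1 + 2 * d := by ring
    rw [e] at h
    exact h (integrableOn_log_norm_riemannZeta_ofReal (by linarith))
  have hval : ∫ σ in Ioi (1 / 2 + d), Real.log ‖riemannZeta ((2 * σ : ℝ) : ℂ)‖ =
      1 / 2 * ∫ σ in Ioi (1 + 2 * d), Real.log ‖riemannZeta σ‖ := by
    have h := MeasureTheory.integral_comp_mul_left_Ioi (fun u : ℝ ↦ Real.log ‖riemannZeta u‖)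
      (1 / 2 + d) two_pos
    have e : (2 : ℝ) * (1 / 2 + d) = 1 + 2 * d := by ring
    rw [e] at h
    simp only [smul_eq_mul] at h
    rw [h]; ring
  have hmono := setIntegral_mono_on
    (f := fun σ : ℝ ↦ Real.log ‖riemannZeta ((2 * σ : ℝ) : ℂ)‖ - Real.log ‖riemannZeta σ‖)
    (hR2.sub hR1) hL measurableSet_Ioi
    (fun σ hσ ↦ log_norm_LFunction_two_mul_sub_le χ (lt_trans hc hσ) t)
  rw [integral_sub hR2 hR1, hval] at hmono
  exact hmono

/-- **The `I(d)` bound, bounded part**: for `½ < d` and `t` not an ordinate,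
`∫_{½+d}^{½+2d} log|L(σ+it, χ)| dσ ≥ ½∫_{1+2d}^{1+4d} log ζ − ∫_{½+d}^{½+2d} log ζ`.
[cite: Trudgian2011, §3.4 proof of Lemma 3.7 (definition of I(d))] -/
theorem intervalIntegral_log_norm_LFunction_ge (h1 : χ ≠ 1) {d t : ℝ} (hd : 1 / 2 < d)
    (ht : ∀ ρ ∈ charNontrivialZeros χ, ρ.im ≠ t) :
    1 / 2 * (∫ σ in (1 + 2 * d)..(1 + 4 * d), Real.log ‖riemannZeta σ‖) -
        (∫ σ in (1 / 2 + d)..(1 / 2 + 2 * d), Real.log ‖riemannZeta σ‖) ≤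
      ∫ σ in (1 / 2 + d)..(1 / 2 + 2 * d), Real.log ‖χ.LFunction (σ + t * I)‖ := by
  have hc : 1 < 1 / 2 + d := by linarith
  have hle : 1 / 2 + d ≤ 1 / 2 + 2 * d := by linarith
  have hL : IntervalIntegrable (fun σ : ℝ ↦ Real.log ‖χ.LFunction (σ + t * I)‖) volume
      (1 / 2 + d) (1 / 2 + 2 * d) :=
    intervalIntegrable_log_norm_LFunction h1 ht (by linarith) (by linarith)
  have hR1 : IntervalIntegrable (fun σ : ℝ ↦ Real.log ‖riemannZeta σ‖) volume
      (1 / 2 + d) (1 / 2 + 2 * d) := intervalIntegrable_log_norm_riemannZeta_ofReal hc (by linarith)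
  have hR2 : IntervalIntegrable (fun σ : ℝ ↦ Real.log ‖riemannZeta ((2 * σ : ℝ) : ℂ)‖) volume
      (1 / 2 + d) (1 / 2 + 2 * d) := by
    have h := (intervalIntegrable_log_norm_riemannZeta_ofReal (a := 2 * (1 / 2 + d))
      (b := 2 * (1 / 2 + 2 * d)) (by linarith) (by linarith)).comp_mul_left (c := 2)
    have e1 : 2 * (1 / 2 + d) / 2 = 1 / 2 + d := by ring
    have e2 : 2 * (1 / 2 + 2 * d) / 2 = 1 / 2 + 2 * d := by ring
    rw [e1, e2] at h
    exact h
  have hval : ∫ σ in (1 / 2 + d)..(1 / 2 + 2 * d), Real.log ‖riemannZeta ((2 * σ : ℝ) : ℂ)‖ =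
      1 / 2 * ∫ σ in (1 + 2 * d)..(1 + 4 * d), Real.log ‖riemannZeta σ‖ := by
    have h := intervalIntegral.integral_comp_mul_left (fun u : ℝ ↦ Real.log ‖riemannZeta u‖)
      (a := 1 / 2 + d) (b := 1 / 2 + 2 * d) (c := 2) two_ne_zero
    have e1 : (2 : ℝ) * (1 / 2 + d) = 1 + 2 * d := by ring
    have e2 : (2 : ℝ) * (1 / 2 + 2 * d) = 1 + 4 * d := by ring
    rw [e1, e2, smul_eq_mul] at h
    rw [h]; ring
  have hmono := intervalIntegral.integral_mono_on hle (hR2.sub hR1) hL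
    (fun σ hσ ↦ log_norm_LFunction_two_mul_sub_le χ (lt_of_lt_of_le hc hσ.1) t)
  rw [intervalIntegral.integral_sub hR2 hR1, hval] at hmono
  exact hmono

/-- **Trudgian's decomposition of `∫ log|L|`** (§3.4: "One writes `∫ log|L(s, χ)| dσ` as a sum of
integrals in the style of" §2.2; Rumely (13)): for `d ≥ 0` and `t` not an ordinate,
`∫_{1/2}^∞ log|L(σ+it)| dσ = ∫_{1/2}^{1/2+d} (log|L(s)| − log|L(s+d)|) dσ
  + ∫_{1/2+d}^{1/2+2d} log|L(σ+it)| dσ + ∫_{1/2+d}^∞ log|L(σ+it)| dσ`.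
[cite: Trudgian2011, §3.4 proof of Lemma 3.7] -/
theorem setIntegral_Ioi_half_log_norm_LFunction_eq_decomp (h1 : χ ≠ 1) {d t : ℝ} (hd : 0 ≤ d)
    (ht : ∀ ρ ∈ charNontrivialZeros χ, ρ.im ≠ t) :
    ∫ σ in Ioi (1 / 2 : ℝ), Real.log ‖χ.LFunction (σ + t * I)‖ =
      (∫ σ in (1 / 2 : ℝ)..(1 / 2 + d),
          (Real.log ‖χ.LFunction (σ + t * I)‖ -
            Real.log ‖χ.LFunction ((σ + d : ℝ) + t * I)‖)) +
        (∫ σ in (1 / 2 + d)..(1 / 2 + 2 * d), Real.log ‖χ.LFunction (σ + t * I)‖) +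
        ∫ σ in Ioi (1 / 2 + d), Real.log ‖χ.LFunction (σ + t * I)‖ := by
  have hI := integrableOn_log_norm_LFunction h1 ht
  have hsplit : ∫ σ in Ioi (1 / 2 : ℝ), Real.log ‖χ.LFunction (σ + t * I)‖ =
      (∫ σ in (1 / 2 : ℝ)..(1 / 2 + d), Real.log ‖χ.LFunction (σ + t * I)‖) +
        ∫ σ in Ioi (1 / 2 + d), Real.log ‖χ.LFunction (σ + t * I)‖ := by
    rw [← Ioc_union_Ioi_eq_Ioi (show (1 / 2 : ℝ) ≤ 1 / 2 + d by linarith),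
      setIntegral_union (Ioc_disjoint_Ioi le_rfl) measurableSet_Ioi
        (hI.mono_set Ioc_subset_Ioi_self) (hI.mono_set (Ioi_subset_Ioi (by linarith))),
      intervalIntegral.integral_of_le (by linarith)]
  have I1 : IntervalIntegrable (fun σ : ℝ ↦ Real.log ‖χ.LFunction (σ + t * I)‖) volume
      (1 / 2) (1 / 2 + d) := intervalIntegrable_log_norm_LFunction h1 ht le_rfl (by linarith)
  have I2 : IntervalIntegrable (fun σ : ℝ ↦ Real.log ‖χ.LFunction ((σ + d : ℝ) + t * I)‖) volume
      (1 / 2) (1 / 2 + d) := by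
    have h := (intervalIntegrable_log_norm_LFunction h1 ht (a := 1 / 2 + d)
      (b := 1 / 2 + d + d) (by linarith) (by linarith)).comp_add_right d
    simp only [add_sub_cancel_right] at h
    exact h
  have hshift : ∫ σ in (1 / 2 : ℝ)..(1 / 2 + d), Real.log ‖χ.LFunction ((σ + d : ℝ) + t * I)‖ =
      ∫ σ in (1 / 2 + d)..(1 / 2 + 2 * d), Real.log ‖χ.LFunction (σ + t * I)‖ := by
    have h := intervalIntegral.integral_comp_add_right
      (fun σ : ℝ ↦ Real.log ‖χ.LFunction (σ + t * I)‖) (a := 1 / 2) (b := 1 / 2 + d) d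
    have e : (1 / 2 : ℝ) + d + d = 1 / 2 + 2 * d := by ring
    rw [e] at h
    exact h
  rw [hsplit, intervalIntegral.integral_sub I1 I2, hshift]
  ring

/-! ### The non-`L` part of `ξ'/ξ(s, χ)`: `½ log(Q/π) + ½ Re ψ((s+a)/2)` -/

omit [NeZero q] in
/-- `(w + a)/2` is no pole of `Γ` for `Re w > 0`. [folklore] -/
private theorem half_add_ne_neg_nat {w : ℂ} (hw : 0 < w.re) (κ : ℕ) (m : ℕ) :
    (w + κ) / 2 ≠ -m := by
  intro h
  have := congrArg Complex.re h
  simp at this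
  have : (0 : ℝ) ≤ κ := Nat.cast_nonneg κ
  linarith

/-- **`Re (ξ'/ξ − L'/L)(w, χ) = ½ log Q − ½ log π + ½ Re ψ((w+a)/2)`** for `Re w > 0`,
`L(w, χ) ≠ 0`, `χ ≠ 1` (`ξ'/ξ = ½ log Q + Γ_ℝ'/Γ_ℝ(w+a) + L'/L`, MV (10.19), the tree's
`DirichletTheta.logDeriv_dirichletXi_eq`; `Γ_ℝ'/Γ_ℝ(u) = −½ log π + ½ ψ(u/2)`).  Trudgian, §3.4 (display "logarithmically differentiate the
Weierstrass product"): `Σ_ρ Re 1/(s−ρ) = ½ log(Q/π) + ½ Re Γ'/Γ((s+δ)/2) + Re L'/L(s, χ)`.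
[cite: Trudgian2011, §3.4 proof of Lemma 3.7] [cite: MontgomeryVaughan2007, (10.19)] -/
theorem re_logDeriv_dirichletXi_sub_eq (h1 : χ ≠ 1) {w : ℂ} (hw : 0 < w.re)
    (hL : χ.LFunction w ≠ 0) :
    (deriv (dirichletXi χ) w / dirichletXi χ w).re -
        (deriv χ.LFunction w / χ.LFunction w).re =
      Real.log q / 2 - Real.log π / 2 + (Complex.digamma ((w + charParity χ) / 2)).re / 2 := by
  have h := logDeriv_dirichletXi_eq h1 hw hL
  have hΓ := Literature.NumberTheory.LFunctions.logDeriv_Gammaℝ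
    (s := w + charParity χ) (half_add_ne_neg_nat hw (charParity χ))
  rw [hΓ, logDeriv_apply] at h
  have hre := congrArg Complex.re h
  rw [hre]
  have hq : ((Real.log q : ℂ) / 2).re = Real.log q / 2 := by
    rw [div_ofNat_re, ofReal_re]
  have hπ : (-(Complex.log π) / 2).re = -(Real.log π) / 2 := by
    rw [← Complex.ofReal_log Real.pi_pos.le, div_ofNat_re, neg_re, ofReal_re]
  have hψ : (Complex.digamma ((w + charParity χ) / 2) / 2).re =
      (Complex.digamma ((w + charParity χ) / 2)).re / 2 := by
    rw [div_ofNat_re]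
  simp only [add_re, hq, hπ, hψ]
  ring

/-- **The non-`L` part of `ξ'/ξ(s, χ)` on a horizontal line**: for `x ≥ ½`, `t ≥ 1`,
`L(x + it, χ) ≠ 0`,
`Re (ξ'/ξ − L'/L)(x + it, χ) ≥ ½ log Q + ½ log t − ½ log 2 − ½ log π − ε(t)`, `ε(t) = turingEps t`
(from `Re ψ(u) ≥ log|u| − 1/(2|u|²) − π/(4|Im u|)` at `u = (x + a + it)/2`, `|u| ≥ t/2`).
Trudgian treats this term by the mean value theorem and his Lemma 2.8: `I₁ ≥ (d²/2){log(t/2) − ε'}`,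
`ε' = 11/t₀²`; Rumely by (22)–(24). [cite: Trudgian2011, §3.4 proof of Lemma 3.7]
[cite: Rumely1993ERH, (22)–(24) p. 432] -/
theorem re_logDeriv_dirichletXi_sub_ge (h1 : χ ≠ 1) {x t : ℝ} (hx : 1 / 2 ≤ x) (ht : 1 ≤ t)
    (hL : χ.LFunction (x + t * I) ≠ 0) :
    Real.log q / 2 + Real.log t / 2 - Real.log 2 / 2 - Real.log π / 2 - turingEps t ≤
      (deriv (dirichletXi χ) (x + t * I) / dirichletXi χ (x + t * I)).re -
        (deriv χ.LFunction (x + t * I) / χ.LFunction (x + t * I)).re := by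
  set w : ℂ := x + t * I with hw
  have hwre : w.re = x := by simp [hw]
  have hwim : w.im = t := by simp [hw]
  have ht0 : 0 < t := by linarith
  have hre : 0 < w.re := by rw [hwre]; linarith
  rw [re_logDeriv_dirichletXi_sub_eq h1 hre hL]
  -- the digamma term at `u = (w + a)/2`
  set u : ℂ := (w + charParity χ) / 2 with hu
  have hκ0 : (0 : ℝ) ≤ charParity χ := Nat.cast_nonneg _
  have hure : 0 < u.re := by
    simp only [hu, div_ofNat_re, add_re, hwre, natCast_re]; linarith
  have huim : u.im = t / 2 := by
    simp only [hu, div_ofNat_im, add_im, hwim, natCast_im, add_zero]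
  have huim' : u.im ≠ 0 := by rw [huim]; linarith
  have hψ := Literature.Analysis.SpecialFunctions.Complex.log_norm_sub_le_re_digamma hure huim'
  have hnorm : t / 2 ≤ ‖u‖ := by
    have := abs_im_le_norm u
    rwa [huim, abs_of_pos (by linarith)] at this
  have hn0 : 0 < ‖u‖ := lt_of_lt_of_le (by linarith) hnorm
  have hlog : Real.log t - Real.log 2 ≤ Real.log ‖u‖ := by
    rw [← Real.log_div ht0.ne' two_ne_zero]; exact Real.log_le_log (by linarith) hnorm
  have hsq : 1 / (2 * ‖u‖ ^ 2) ≤ 2 / t ^ 2 := by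
    rw [div_le_div_iff₀ (by positivity) (by positivity)]
    nlinarith [hnorm, hn0]
  have habs : π / (4 * |u.im|) = π / (2 * t) := by
    rw [huim, abs_of_pos (by linarith)]; ring
  rw [habs] at hψ
  simp only [turingEps]
  have e3 : (3 : ℝ) / (2 * t ^ 2) = 1 / (2 * t ^ 2) + 2 / t ^ 2 / 2 := by
    field_simp; ring
  have e4 : π / (4 * t) = π / (2 * t) / 2 := by field_simp; ring
  rw [e3, e4]
  have h5 : 0 ≤ 1 / (2 * t ^ 2) := by positivity
  linarith

/-! ### Per-abscissa and integrated lower bound for `log|L(s)/L(s+d)|` -/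

/-- **The non-`L` part of `log|L(s, χ)/L(s+d, χ)|`, integrated along `[σ, σ+d]`**: for `σ ≥ ½`,
`d ≥ 0`, `t ≥ 1` not an ordinate (`χ` primitive, `≠ 1`),
`log|L(σ+it)| − log|L(σ+d+it)| ≥ (log|ξ(σ+it, χ)| − log|ξ(σ+d+it, χ)|)
  + d(½ log Q + ½ log t − ½ log 2π − ε(t))`
(horizontal FTC for `log|L|` and `log|ξ|`, and `re_logDeriv_dirichletXi_sub_ge`): the terms
`(d²/2) log(Q/π) + I₁` of Trudgian's proof of Lemma 3.7 before integration over `σ`.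
[cite: Trudgian2011, §3.4 proof of Lemma 3.7] -/
theorem log_norm_LFunction_sub_shift_ge (hχ : χ.IsPrimitive) (h1 : χ ≠ 1) {σ d t : ℝ}
    (hσ : 1 / 2 ≤ σ) (hd : 0 ≤ d) (ht : 1 ≤ t) (hord : ∀ ρ ∈ charNontrivialZeros χ, ρ.im ≠ t) :
    (Real.log ‖dirichletXi χ (σ + t * I)‖ - Real.log ‖dirichletXi χ ((σ + d : ℝ) + t * I)‖) +
      d * (Real.log q / 2 + Real.log t / 2 - Real.log 2 / 2 - Real.log π / 2 - turingEps t) ≤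
    Real.log ‖χ.LFunction (σ + t * I)‖ - Real.log ‖χ.LFunction ((σ + d : ℝ) + t * I)‖ := by
  have hL : ∀ x : ℝ, 1 / 2 ≤ x → χ.LFunction (x + t * I) ≠ 0 := fun x hx ↦
    LFunction_ne_zero_of_half_le' h1 hord hx
  have hξ : ∀ x : ℝ, dirichletXi χ (x + t * I) ≠ 0 := fun x ↦
    dirichletXi_ne_zero_of_im_eq hχ h1 hord (by simp)
  have hLa : ∀ x ∈ Icc σ (σ + d), AnalyticAt ℂ χ.LFunction (x + t * I) := fun x _ ↦
    (differentiable_LFunction h1).analyticAt _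
  have hξa : ∀ x ∈ Icc σ (σ + d), AnalyticAt ℂ (dirichletXi χ) (x + t * I) := fun x _ ↦
    (differentiable_dirichletXi h1).analyticAt _
  have hσd : σ ≤ σ + d := by linarith
  have hL' : ∀ x ∈ Icc σ (σ + d), χ.LFunction (x + t * I) ≠ 0 := fun x hx ↦ hL x (hσ.trans hx.1)
  have FL := integral_re_logDeriv_horizontal hσd hLa hL'
  have Fξ := integral_re_logDeriv_horizontal hσd hξa (fun x _ ↦ hξ x)
  have IL := (continuousOn_re_logDeriv_horizontal hLa hL').intervalIntegrable_of_Icc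
    (μ := volume) hσd
  have Iξ := (continuousOn_re_logDeriv_horizontal hξa (fun x _ ↦ hξ x)).intervalIntegrable_of_Icc
    (μ := volume) hσd
  set c : ℝ := Real.log q / 2 + Real.log t / 2 - Real.log 2 / 2 - Real.log π / 2 - turingEps t
    with hc
  have hpt : ∀ x ∈ Icc σ (σ + d), c ≤
      (deriv (dirichletXi χ) (x + t * I) / dirichletXi χ (x + t * I)).re -
        (deriv χ.LFunction (x + t * I) / χ.LFunction (x + t * I)).re :=
    fun x hx ↦ re_logDeriv_dirichletXi_sub_ge h1 (hσ.trans hx.1) ht (hL' x hx)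
  have hmono := intervalIntegral.integral_mono_on hσd intervalIntegrable_const (Iξ.sub IL) hpt
  rw [intervalIntegral.integral_const, intervalIntegral.integral_sub Iξ IL, FL, Fξ, smul_eq_mul]
    at hmono
  have e : (σ + d - σ) * c = d * c := by ring
  rw [e] at hmono
  push_cast at hmono ⊢
  linarith

/-- `σ ↦ log|ξ(σ + it, χ)|` is continuous (`t` not an ordinate). [folklore] -/
private theorem continuous_log_norm_dirichletXi (hχ : χ.IsPrimitive) (h1 : χ ≠ 1) {t : ℝ}
    (hord : ∀ ρ ∈ charNontrivialZeros χ, ρ.im ≠ t) :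
    Continuous fun x : ℝ ↦ Real.log ‖dirichletXi χ (x + t * I)‖ := by
  have hξ : ∀ x : ℝ, dirichletXi χ (x + t * I) ≠ 0 := fun x ↦
    dirichletXi_ne_zero_of_im_eq hχ h1 hord (by simp)
  have hc : Continuous fun x : ℝ ↦ dirichletXi χ (x + t * I) :=
    (differentiable_dirichletXi h1).continuous.comp (by fun_prop)
  exact continuous_iff_continuousAt.2 fun x ↦
    (hc.continuousAt.norm).log (norm_ne_zero_iff.2 (hξ x))

/-- **The first integral of Trudgian's decomposition** (proof of Lemma 3.7; Rumely (19)–(24) for the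
`Γ`- and `Q/π`-terms): for `d ≥ 0`, `t ≥ 1` not an ordinate, `χ` primitive mod `Q > 1`,
`∫_{1/2}^{1/2+d} (log|L(σ+it)| − log|L(σ+d+it)|) dσ
   ≥ ∫_{1/2}^{1/2+d} (log|ξ(σ+it, χ)| − log|ξ(σ+d+it, χ)|) dσ + d²(½ log(Qt) − ½ log 2π − ε(t))`.
[cite: Trudgian2011, §3.4 proof of Lemma 3.7] [cite: Rumely1993ERH, (19)–(24) pp. 431–432] -/
theorem integral_log_norm_LFunction_sub_shift_ge (hχ : χ.IsPrimitive) (h1 : χ ≠ 1) {d t : ℝ}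
    (hd : 0 ≤ d) (ht : 1 ≤ t) (hord : ∀ ρ ∈ charNontrivialZeros χ, ρ.im ≠ t) :
    (∫ σ in (1 / 2 : ℝ)..(1 / 2 + d),
        (Real.log ‖dirichletXi χ (σ + t * I)‖ -
          Real.log ‖dirichletXi χ ((σ + d : ℝ) + t * I)‖)) +
      d ^ 2 * (Real.log q / 2 + Real.log t / 2 - Real.log 2 / 2 - Real.log π / 2 - turingEps t) ≤
    ∫ σ in (1 / 2 : ℝ)..(1 / 2 + d),
        (Real.log ‖χ.LFunction (σ + t * I)‖ - Real.log ‖χ.LFunction ((σ + d : ℝ) + t * I)‖) := by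
  set c : ℝ := Real.log q / 2 + Real.log t / 2 - Real.log 2 / 2 - Real.log π / 2 - turingEps t
    with hc
  have hle : (1 / 2 : ℝ) ≤ 1 / 2 + d := by linarith
  have I1 : IntervalIntegrable (fun σ : ℝ ↦ Real.log ‖χ.LFunction (σ + t * I)‖) volume
      (1 / 2) (1 / 2 + d) := intervalIntegrable_log_norm_LFunction h1 hord le_rfl hle
  have I2 : IntervalIntegrable (fun σ : ℝ ↦ Real.log ‖χ.LFunction ((σ + d : ℝ) + t * I)‖) volume
      (1 / 2) (1 / 2 + d) := by
    have h := (intervalIntegrable_log_norm_LFunction h1 hord hle (b := 1 / 2 + d + d)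
      (by linarith)).comp_add_right d
    simp only [add_sub_cancel_right] at h
    exact h
  have hξc := continuous_log_norm_dirichletXi hχ h1 hord
  have I3 : IntervalIntegrable (fun σ : ℝ ↦ Real.log ‖dirichletXi χ (σ + t * I)‖ -
      Real.log ‖dirichletXi χ ((σ + d : ℝ) + t * I)‖) volume (1 / 2) (1 / 2 + d) :=
    (hξc.intervalIntegrable _ _).sub ((hξc.comp (continuous_id.add continuous_const :
      Continuous fun σ : ℝ ↦ σ + d)).intervalIntegrable _ _)
  have hpt : ∀ σ ∈ Icc (1 / 2 : ℝ) (1 / 2 + d),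
      (Real.log ‖dirichletXi χ (σ + t * I)‖ - Real.log ‖dirichletXi χ ((σ + d : ℝ) + t * I)‖) +
        d * c ≤
      Real.log ‖χ.LFunction (σ + t * I)‖ - Real.log ‖χ.LFunction ((σ + d : ℝ) + t * I)‖ :=
    fun σ hσ ↦ log_norm_LFunction_sub_shift_ge hχ h1 hσ.1 hd ht hord
  have hmono := intervalIntegral.integral_mono_on hle (I3.add intervalIntegrable_const) (I1.sub I2)
    hpt
  rw [intervalIntegral.integral_add I3 intervalIntegrable_const, intervalIntegral.integral_const,
    smul_eq_mul] at hmono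
  have e : (1 / 2 + d - 1 / 2) * (d * c) = d ^ 2 * c := by ring
  rw [e] at hmono
  exact hmono

/-- **Trudgian 2011, Lemma 3.7 assembled modulo the zeros' part** (§3.4 proof of Lemma 3.7; Rumely
(13)–(25)): for `½ < d`, `t ≥ 1` not an ordinate, `χ` primitive mod `Q > 1`, and any bound
`∫_{1/2}^{1/2+d} (log|ξ(σ+it, χ)| − log|ξ(σ+d+it, χ)|) dσ ≥ −X` for the `ξ`-part (the source's
`I₂ ≥ −d²(log 4) Re ξ'/ξ(½ + d + it, χ)`-step, NOT proved here),
`−∫_{1/2}^∞ log|L(σ+it, χ)| dσ ≤ X − d²(½ log Q + ½ log t − ½ log 2π − ε(t)) − I(d)`,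
`I(d) = turingI d` (Trudgian's `I(d)` of §2.2), `ε(t) = turingEps t`.
[cite: Trudgian2011, §3.4 Lemma 3.7 (proof)] -/
theorem neg_setIntegral_Ioi_half_log_norm_LFunction_le_of_xi_bound (hχ : χ.IsPrimitive)
    (h1 : χ ≠ 1) {d t X : ℝ} (hd : 1 / 2 < d) (ht : 1 ≤ t)
    (hord : ∀ ρ ∈ charNontrivialZeros χ, ρ.im ≠ t)
    (hX : -X ≤ ∫ σ in (1 / 2 : ℝ)..(1 / 2 + d),
        (Real.log ‖dirichletXi χ (σ + t * I)‖ - Real.log ‖dirichletXi χ ((σ + d : ℝ) + t * I)‖)) :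
    -(∫ σ in Ioi (1 / 2 : ℝ), Real.log ‖χ.LFunction (σ + t * I)‖) ≤
      X - d ^ 2 * (Real.log q / 2 + Real.log t / 2 - Real.log 2 / 2 - Real.log π / 2 - turingEps t) -
        turingI d := by
  have hdec := setIntegral_Ioi_half_log_norm_LFunction_eq_decomp h1 (by linarith : (0:ℝ) ≤ d) hord
  have hA := integral_log_norm_LFunction_sub_shift_ge hχ h1 (by linarith : (0:ℝ) ≤ d) ht hord
  have hJ₁ := intervalIntegral_log_norm_LFunction_ge h1 hd hord
  have hJ₂ := setIntegral_Ioi_log_norm_LFunction_ge h1 hd hord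
  simp only [turingI]
  rw [hdec]
  linarith

end TuringDirichlet

end Literature.NumberTheory.LFunctions

end
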